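import Summits.BirchSwinnertonDyer.Rank1Residual.Additive.X4SharpThreeAssemblyManinFreeNoLemma20
import Summits.BirchSwinnertonDyer.Rank1Residual.Additive.X4RankZeroCoveredLocusManinFree
import Summits.BirchSwinnertonDyer.Rank1Residual.Additive.X4RankZeroKatoBoundTamagawaExact
import Summits.BirchSwinnertonDyer.Rank1Residual.Additive.N10IsogenyTransport
import Summits.BirchSwinnertonDyer.Rank1Residual.Supersingular.DescentLowerBound
import HarnessLib

/-!
# Route `AdditiveBranchIMC` (rung K1), crux `GordTwoRankZeroOffCaseOne` (item 19357): the rank-ZERO `3`-DESCENT door, X4♯(3) form —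
# the TAMAGAWA-DEFECT twins of `…Desc3DoorManinFree` (cell `bsd-addord`, seat `bsd-addord-k1-c2` gen 8; planner g22 ask «a Tamagawa-free X4♯(3)
# door for the 225 cell-C WALL2 rows», HOME/TARGET E243, HANDOFF § plan g22)

HONEST FRAMING. THEOREMS ONLY: no definition, no named fact, no `sorry`, nothing booked; BSD is not proved by any of this; the crux stays OPEN at
class level. The booked Manin-free door `bsdp_three_of_x4Cert_of_selmerGroup_ne_bot_maninFree` (p521298; referee A R695, token T-X4U2-DESC3-r0)
carries the datum `htam : ¬ 3 ∣ ∏_ℓ c_ℓ` (KUR3 cell U). That binder is stronger than what its proof uses: on the potentially good branch the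
Manin-free SHARP Kato reading A161′ (`Kato2004.rankZero_padicValNat_sha_le_sub_localTamagawa_of_additive_potGood_of_imageContainsSL2_maninFree`,
Kato 2004 Thm. 14.5 (3) in Prop. 14.16 (2): `ord₃ #Ш ≤ ord₃(L(E,1)/Ω) − v₃(c₃)`) bounds `ord₃ #Ш` by `ord₃ #Ш_an + ord₃ ∏_ℓ c_ℓ − v₃(c₃)` — only the
Tamagawa DEFECT `d := ord₃ ∏_ℓ c_ℓ − v₃(c₃) = Σ_{ℓ ≠ 3} v₃(c_ℓ)` is lost, not `v₃(c₃)` — and the (M) branch (`ord₃ j < 0`: Delbourgo 1998 Prop. 4 +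
Kato's `ω`-component divisibility) uses no Tamagawa datum at all. Hence, by pure composition of tree theorems of the b2b chain of record
(additive-p4 V34 `X4RankZeroCoveredLocusManinFree`, n1011 p08 `X4RankZeroKatoBoundManinFree`, n1011 p04 `X4RankZeroKatoBoundTamagawaExact`):
* §1 `d = 0` (the `3` in `∏ c_ℓ` sits in `c₃` alone, e.g. Kodaira IV / IV* at `3`): `…_tamLocal` — `htam` replaced by
  `ord₃ ∏_ℓ c_ℓ = v₃(c₃)`, everything else as booked;
* §2 `d ≤ 1` with Cassels–Tate squareness (`hCT`, ALREADY a binder of the booked door, makes `ord₃ #Ш` even): `…_tamDefect[_of_even]` — `htam`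
  replaced by `ord₃ ∏_ℓ c_ℓ ≤ v₃(c₃) + 1`, and `ord₃ #Ш_an` even (census datum `ord₃ #Ш_an = 2`): `2 ≤ ord₃ #Ш ≤ 3` and even ⟹ `= 2`;
* §3 NO Tamagawa binder at all, on the Tamagawa-EXACT reading A161″ = b2b registry A305
  (`Kato2004.rankZero_padicValNat_sha_add_padicValNat_tamagawa_le_of_additive_potGood_of_imageContainsSL2`: Kato Thm. 14.5 (3) + Prop. 14.16 (2)
  + §14.8 with Greenberg LNM 1716 Prop. 4.13 / Lemma 3.3 for `[S(T) : Sel(T)] = ∏_{ℓ ≠ p} c_ℓ^{(p)}`; tier-D reading-fact, REFEREE 2 concur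
  2026-08-22): `…_katoTam` — reaches every defect;
* §4 isogeny-class forms (Cassels `hCassels`), §5 bookkeeping (`¬ 3 ∣ ∏ c_ℓ` ⟹ both new Tamagawa binders, so the cell-U rows satisfy them too).
The LOWER half is the class-free `3`-descent certificate line `Sel^(3)(E/ℚ) ≠ 0` exactly as in the booked door
(`Supersingular.missingLowerBoundAt_of_casselsTate_of_selmerGroup_ne_bot`: rank `0` by GZK, `E[3]` irreducible ⟹ no rational `3`-torsion,
Cassels–Tate ⟹ `9 ∣ #Ш`). Clientele (planner's KUR3-COVERAGE-v1 cell C of W-ALL row 2 @3 r0, types W / T′ / Gss2, `s = ord₃ #Ш_an = 2`; table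
`HOME/k1-c2/g7/DESC3-WTG-U2-certs-g7.tsv`, 225 rows, certificates kit j275145 / j277177): §2 serves every row with `v₃(∏ c_ℓ) = 1` (208 rows)
and the `v₃(∏ c_ℓ) = 2` rows with `3 ∣ c₃`; §3 serves all 225 (per-row Tamagawa table: HOME/k1-c2/g8/, kit j277666). Per pair; nothing of
bsd-potss's is restated. A separate module so that the modules importing `…Desc3Door` / `…Desc3DoorManinFree` are not rebuilt.
References: [Kato2004Asterisque] Thm. 14.5 (3) (p. 236), Prop. 14.16 (2) (p. 244), §14.8 (p. 238), Thm. 17.4 (3) (p. 273); [GreenbergLNM1716]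
§4 Prop. 4.13, §3 Lemma 3.3; [Delbourgo1998] Prop. 4 (p. 144); [Wuthrich2014] Lemma 20 (p. 399); [SilvermanAEC2009] Thm. X.4.14;
[MilneADT2006] Thm. I.7.3; [Miller2011LMS] Def. 1.1; [SchaeferStoll2004].
-/

noncomputable section

open scoped Classical

open WeierstrassCurve Literature.NumberTheory.EllipticCurves
  Literature.NumberTheory.EllipticCurves.ModularForms
  Literature.NumberTheory.EllipticCurves.Rank1Residual
  Literature.NumberTheory.EllipticCurves.Rank1Residual.Typed
  Literature.NumberTheory.GaloisRepresentations

set_option linter.dupNamespace false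
set_option autoImplicit false

namespace Summit.BirchSwinnertonDyer.BirchSwinnertonDyer.Theorems.AdditiveBranchIMCGordTwoRankZeroDesc3

open Summit.BirchSwinnertonDyer.Rank1Residual
open Summit.BirchSwinnertonDyer.Rank1Residual.Additive

variable (W : WeierstrassCurve ℚ) [W.IsElliptic] [W.IsGloballyMinimal]

/-! ### §0 The `3`-adic image certificate splits off the (M) branch (bookkeeping shared by §1–§3) -/

omit [W.IsGloballyMinimal] in
/-- On a row with `ord₃ j ≥ 0` the certificate [`ord₃ j < 0` ∨ `j`-witness ∨ surj(9)] is its last two disjuncts, hence (with surj(3)) the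
tower `ρ̄_{E,3ⁿ}` onto for all `n` (`towerSurj_three_of_surj_of_jWitness_or_nine`). Bookkeeping. [cite: SerreAbelianLadic1968, Ch. IV §3.4, Lemma 3 (IV-23)] -/
theorem towerSurj_three_of_cert_of_not_potMult (hsurj : Surj W 3)
    (hcert : padicValRat 3 W.j < 0 ∨
      (∃ q : ℕ, q.Prime ∧ q ≠ 3 ∧ padicValRat q W.j < 0 ∧ ¬ (3 : ℤ) ∣ padicValRat q W.j) ∨
        W.HasSurjectiveModNGaloisRep 9)
    (hj : ¬ padicValRat 3 W.j < 0) (n : ℕ) : W.HasSurjectiveModNGaloisRep (3 ^ n : ℕ) := by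
  have hc' : (∃ q : ℕ, q.Prime ∧ q ≠ 3 ∧ padicValRat q W.j < 0 ∧ ¬ (3 : ℤ) ∣ padicValRat q W.j) ∨
      W.HasSurjectiveModNGaloisRep 9 := by
    rcases hcert with h | h | h
    · exact absurd h hj
    · exact Or.inl h
    · exact Or.inr h
  exact towerSurj_three_of_surj_of_jWitness_or_nine W hsurj hc' n

/-! ### §1 Defect `0`: the `3` of `∏ c_ℓ` sits in `c₃` alone -/

/-- **The typed UPPER half on an X4♯(3) certified row whose Tamagawa `3`-part is LOCAL AT `3`** (`ord₃ ∏_ℓ c_ℓ = v₃(c₃)`, i.e. `3 ∤ c_ℓ` for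
`ℓ ≠ 3`; `c₃ = 3` allowed): binders {hKato = A161′ Manin-free SHARP reading, hDel, hGZK, hmod, hmodD, hKatoω} + row data (`ClassX4 W 3`,
surj(3), the `3`-adic image certificate [`ord₃ j < 0` ∨ `j`-witness ∨ surj(9)], `ord₃ ∏ c_ℓ = v₃(c₃)`) ⟹ `MissingUpperBoundAt W 3`. The (M) branch
(`ord₃ j < 0`) is additive-p1's `ClassX4M.missingUpperBoundAt_three_rankZero_of_surj` (Wuthrich's Lemma 20 fed as the tree theorem `…_holds`);
the potentially good branch is n1011 p08's `X4RankZero.missingUpperBoundAt_of_katoManinFree` — whose Tamagawa hypothesis IS this one.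
[cite: Kato2004Asterisque, Thm. 14.5 (3) (p. 236), Prop. 14.16 (2) (p. 244), Thm. 17.4 (3) (p. 273)] [cite: Delbourgo1998, Prop. 4 (p. 144)]
[cite: Wuthrich2014, Lemma 20 (p. 399)] [cite: Miller2011LMS, Def. 1.1] -/
theorem missingUpperBoundAt_three_of_x4Cert_tamLocal
    (hKato : Kato2004.rankZero_padicValNat_sha_le_sub_localTamagawa_of_additive_potGood_of_imageContainsSL2_maninFree)
    (hDel : Delbourgo1998.prop4_rankZero_pow_dvd_constantCoeff)
    (hGZK : rank_eq_analyticRank_of_analyticRank_le_one) (hmod : hasEntireLFunction_rat)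
    (hmodD : nonempty_modularParametrizationData)
    (hKatoω : Wuthrich2014.kato_minusEigenCharIdeal_dvd_cyclotomicThree_of_surjective)
    (hr : W.analyticRank = 0) (hX : ClassX4 W 3) (hsurj : Surj W 3)
    (hcert : padicValRat 3 W.j < 0 ∨
      (∃ q : ℕ, q.Prime ∧ q ≠ 3 ∧ padicValRat q W.j < 0 ∧ ¬ (3 : ℤ) ∣ padicValRat q W.j) ∨
        W.HasSurjectiveModNGaloisRep 9)
    (htam : padicValNat 3 W.tamagawaProduct = padicValNat 3 ((W.baseChange ℚ_[3]).localTamagawaNumber ℤ_[3])) :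
    MissingUpperBoundAt W 3 := by
  haveI : Fact (Nat.Prime 3) := ⟨Nat.prime_three⟩
  by_cases hj : padicValRat 3 W.j < 0
  · exact AdditivePotMult.ClassX4M.missingUpperBoundAt_three_rankZero_of_surj hDel hGZK hmod hmodD
      Wuthrich2014.lemma20_surjective_threeAdic_of_semistable_holds hKatoω ⟨hX, hX.2.1, hj⟩ hr hsurj
  · exact X4RankZero.missingUpperBoundAt_of_katoManinFree W 3 hKato hGZK hmod hr hX (not_lt.mp hj)
      (towerSurj_three_of_cert_of_not_potMult W hsurj hcert hj) htam

/-- **`BSD(E,3)` on an X4♯(3) row with `ord₃ #Ш_an ≤ 2` from the certificate line `Sel^(3)(E/ℚ) ≠ 0` — Tamagawa `3`-part LOCAL AT `3`**: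
the booked door `bsdp_three_of_x4Cert_of_selmerGroup_ne_bot_maninFree` with its binder `¬ 3 ∣ ∏ c_ℓ` REPLACED by `ord₃ ∏ c_ℓ = v₃(c₃)`
(defect `0`; `c₃ = 3` allowed), every other binder unchanged: {hKato, hDel, hGZK, hmod, hmodD, hKatoω, hCT} + row data + `hSel`. Per pair; nothing
booked here. [cite: Kato2004Asterisque, Thm. 14.5 (3) (p. 236), Thm. 17.4 (3) (p. 273)] [cite: Delbourgo1998, Prop. 4 (p. 144)]
[cite: Wuthrich2014, Lemma 20 (p. 399)] [cite: SilvermanAEC2009, Thm. X.4.14] [cite: Miller2011LMS, §1 and Def. 1.1] -/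
theorem bsdp_three_of_x4Cert_of_selmerGroup_ne_bot_tamLocal
    (hKato : Kato2004.rankZero_padicValNat_sha_le_sub_localTamagawa_of_additive_potGood_of_imageContainsSL2_maninFree)
    (hDel : Delbourgo1998.prop4_rankZero_pow_dvd_constantCoeff)
    (hGZK : rank_eq_analyticRank_of_analyticRank_le_one) (hmod : hasEntireLFunction_rat)
    (hmodD : nonempty_modularParametrizationData)
    (hKatoω : Wuthrich2014.kato_minusEigenCharIdeal_dvd_cyclotomicThree_of_surjective)
    (hCT : exists_casselsTate_pairing (K := ℚ))
    (hr : W.analyticRank = 0) (hX : ClassX4 W 3) (hsurj : Surj W 3)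
    (hcert : padicValRat 3 W.j < 0 ∨
      (∃ q : ℕ, q.Prime ∧ q ≠ 3 ∧ padicValRat q W.j < 0 ∧ ¬ (3 : ℤ) ∣ padicValRat q W.j) ∨
        W.HasSurjectiveModNGaloisRep 9)
    (htam : padicValNat 3 W.tamagawaProduct = padicValNat 3 ((W.baseChange ℚ_[3]).localTamagawaNumber ℤ_[3]))
    {q : ℚ} (hq : shaAn W = (q : ℂ)) (hv : padicValRat 3 q ≤ 2) (hSel : W.selmerGroup (3 : ℤ) ≠ ⊥) : BSDp W 3 :=
  haveI : Fact (Nat.Prime 3) := ⟨Nat.prime_three⟩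
  bsdp_of_missingPPartAt W 3 hGZK (by rw [hr]; exact zero_le_one)
    (missingPPartAt_of_lower_of_upper W 3
      (Supersingular.missingLowerBoundAt_of_casselsTate_of_selmerGroup_ne_bot W 3 hCT hGZK hr
        (Supersingular.not_dvd_torsionOrder_of_irr W 3 hX.2.2) hq hv hSel)
      (missingUpperBoundAt_three_of_x4Cert_tamLocal W hKato hDel hGZK hmod hmodD hKatoω hr hX hsurj hcert htam))

/-! ### §2 Defect `≤ 1` with Cassels–Tate squareness -/

/-- **The typed UPPER half on an X4♯(3) certified row of Tamagawa DEFECT `≤ 1` with `ord₃ #Ш_an` EVEN**: binders {hCT, hKato = A161′, hDel, hGZK,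
hmod, hmodD, hKatoω} + row data (`ClassX4 W 3`, surj(3), the `3`-adic image certificate, `ord₃ ∏ c_ℓ ≤ v₃(c₃) + 1`, `#Ш_an = q` with `ord₃ q`
even) ⟹ `MissingUpperBoundAt W 3`. The (M) branch needs no Tamagawa datum; the potentially good branch is additive-p4 V34's
`X4RankZero.missingUpperBoundAt_of_katoManinFree_of_casselsTate_of_tamDefect_le_one_of_even` (`ord₃ #Ш ≤ ord₃ q + 1` and `ord₃ #Ш` even by
Cassels–Tate ⟹ `ord₃ #Ш ≤ ord₃ q`). [cite: Kato2004Asterisque, Thm. 14.5 (3) (p. 236), Prop. 14.16 (2) (p. 244), Thm. 17.4 (3) (p. 273)]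
[cite: Delbourgo1998, Prop. 4 (p. 144)] [cite: Wuthrich2014, Lemma 20 (p. 399)] [cite: SilvermanAEC2009, Thm. X.4.14] [cite: Miller2011LMS, Def. 1.1] -/
theorem missingUpperBoundAt_three_of_x4Cert_of_casselsTate_of_tamDefect_le_one_of_even
    (hCT : exists_casselsTate_pairing (K := ℚ))
    (hKato : Kato2004.rankZero_padicValNat_sha_le_sub_localTamagawa_of_additive_potGood_of_imageContainsSL2_maninFree)
    (hDel : Delbourgo1998.prop4_rankZero_pow_dvd_constantCoeff)
    (hGZK : rank_eq_analyticRank_of_analyticRank_le_one) (hmod : hasEntireLFunction_rat)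
    (hmodD : nonempty_modularParametrizationData)
    (hKatoω : Wuthrich2014.kato_minusEigenCharIdeal_dvd_cyclotomicThree_of_surjective)
    (hr : W.analyticRank = 0) (hX : ClassX4 W 3) (hsurj : Surj W 3)
    (hcert : padicValRat 3 W.j < 0 ∨
      (∃ q : ℕ, q.Prime ∧ q ≠ 3 ∧ padicValRat q W.j < 0 ∧ ¬ (3 : ℤ) ∣ padicValRat q W.j) ∨
        W.HasSurjectiveModNGaloisRep 9)
    (htam : padicValNat 3 W.tamagawaProduct ≤ padicValNat 3 ((W.baseChange ℚ_[3]).localTamagawaNumber ℤ_[3]) + 1)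
    {q : ℚ} (hq : shaAn W = (q : ℂ)) (heven : Even (padicValRat 3 q)) : MissingUpperBoundAt W 3 := by
  haveI : Fact (Nat.Prime 3) := ⟨Nat.prime_three⟩
  by_cases hj : padicValRat 3 W.j < 0
  · exact AdditivePotMult.ClassX4M.missingUpperBoundAt_three_rankZero_of_surj hDel hGZK hmod hmodD
      Wuthrich2014.lemma20_surjective_threeAdic_of_semistable_holds hKatoω ⟨hX, hX.2.1, hj⟩ hr hsurj
  · exact X4RankZero.missingUpperBoundAt_of_katoManinFree_of_casselsTate_of_tamDefect_le_one_of_even W 3 hCT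
      hKato hGZK hmod hr hX (not_lt.mp hj) (towerSurj_three_of_cert_of_not_potMult W hsurj hcert hj) htam hq heven

/-- **`BSD(E,3)` on an X4♯(3) row with `ord₃ #Ш_an ≤ 2` EVEN from the certificate line `Sel^(3)(E/ℚ) ≠ 0` — Tamagawa DEFECT `≤ 1`**: the booked
door `bsdp_three_of_x4Cert_of_selmerGroup_ne_bot_maninFree` with `¬ 3 ∣ ∏ c_ℓ` REPLACED by `ord₃ ∏ c_ℓ ≤ v₃(c₃) + 1` plus the parity datum
`Even (ord₃ q)`; every other binder unchanged: {hKato, hDel, hGZK, hmod, hmodD, hKatoω, hCT} + row data + `hSel`. Per pair; nothing booked here.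
[cite: Kato2004Asterisque, Thm. 14.5 (3) (p. 236), Prop. 14.16 (2) (p. 244), Thm. 17.4 (3) (p. 273)] [cite: Delbourgo1998, Prop. 4 (p. 144)]
[cite: Wuthrich2014, Lemma 20 (p. 399)] [cite: SilvermanAEC2009, Thm. X.4.14] [cite: Miller2011LMS, §1 and Def. 1.1] -/
theorem bsdp_three_of_x4Cert_of_selmerGroup_ne_bot_tamDefect_of_even
    (hKato : Kato2004.rankZero_padicValNat_sha_le_sub_localTamagawa_of_additive_potGood_of_imageContainsSL2_maninFree)
    (hDel : Delbourgo1998.prop4_rankZero_pow_dvd_constantCoeff)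
    (hGZK : rank_eq_analyticRank_of_analyticRank_le_one) (hmod : hasEntireLFunction_rat)
    (hmodD : nonempty_modularParametrizationData)
    (hKatoω : Wuthrich2014.kato_minusEigenCharIdeal_dvd_cyclotomicThree_of_surjective)
    (hCT : exists_casselsTate_pairing (K := ℚ))
    (hr : W.analyticRank = 0) (hX : ClassX4 W 3) (hsurj : Surj W 3)
    (hcert : padicValRat 3 W.j < 0 ∨
      (∃ q : ℕ, q.Prime ∧ q ≠ 3 ∧ padicValRat q W.j < 0 ∧ ¬ (3 : ℤ) ∣ padicValRat q W.j) ∨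
        W.HasSurjectiveModNGaloisRep 9)
    (htam : padicValNat 3 W.tamagawaProduct ≤ padicValNat 3 ((W.baseChange ℚ_[3]).localTamagawaNumber ℤ_[3]) + 1)
    {q : ℚ} (hq : shaAn W = (q : ℂ)) (hv : padicValRat 3 q ≤ 2) (heven : Even (padicValRat 3 q))
    (hSel : W.selmerGroup (3 : ℤ) ≠ ⊥) : BSDp W 3 :=
  haveI : Fact (Nat.Prime 3) := ⟨Nat.prime_three⟩
  bsdp_of_missingPPartAt W 3 hGZK (by rw [hr]; exact zero_le_one)
    (missingPPartAt_of_lower_of_upper W 3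
      (Supersingular.missingLowerBoundAt_of_casselsTate_of_selmerGroup_ne_bot W 3 hCT hGZK hr
        (Supersingular.not_dvd_torsionOrder_of_irr W 3 hX.2.2) hq hv hSel)
      (missingUpperBoundAt_three_of_x4Cert_of_casselsTate_of_tamDefect_le_one_of_even W hCT hKato hDel hGZK hmod
        hmodD hKatoω hr hX hsurj hcert htam hq heven))

/-- **CENSUS SHAPE of §2 — `ord₃ #Ш_an = 2` exactly** (the `s = 2` datum of every KUR3 U(s = 2) / cell-C row): the booked door
`bsdp_three_of_x4Cert_of_selmerGroup_ne_bot_maninFree` with `¬ 3 ∣ ∏ c_ℓ` REPLACED by `ord₃ ∏ c_ℓ ≤ v₃(c₃) + 1` and `ord₃ q ≤ 2` by `ord₃ q = 2`;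
binders {hKato, hDel, hGZK, hmod, hmodD, hKatoω, hCT} + row data (`r_an = 0`, `ClassX4 W 3`, surj(3), the `3`-adic image certificate,
`ord₃ ∏ c_ℓ ≤ v₃(c₃) + 1`, `#Ш_an = q` with `ord₃ q = 2`) + `hSel : Sel^(3)(E/ℚ) ≠ 0` ⟹ `BSD(E,3)`. Per pair; nothing booked here.
[cite: Kato2004Asterisque, Thm. 14.5 (3) (p. 236), Prop. 14.16 (2) (p. 244), Thm. 17.4 (3) (p. 273)] [cite: Delbourgo1998, Prop. 4 (p. 144)]
[cite: Wuthrich2014, Lemma 20 (p. 399)] [cite: SilvermanAEC2009, Thm. X.4.14] [cite: Miller2011LMS, §1 and Def. 1.1] -/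
theorem bsdp_three_of_x4Cert_of_selmerGroup_ne_bot_tamDefect
    (hKato : Kato2004.rankZero_padicValNat_sha_le_sub_localTamagawa_of_additive_potGood_of_imageContainsSL2_maninFree)
    (hDel : Delbourgo1998.prop4_rankZero_pow_dvd_constantCoeff)
    (hGZK : rank_eq_analyticRank_of_analyticRank_le_one) (hmod : hasEntireLFunction_rat)
    (hmodD : nonempty_modularParametrizationData)
    (hKatoω : Wuthrich2014.kato_minusEigenCharIdeal_dvd_cyclotomicThree_of_surjective)
    (hCT : exists_casselsTate_pairing (K := ℚ))
    (hr : W.analyticRank = 0) (hX : ClassX4 W 3) (hsurj : Surj W 3)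
    (hcert : padicValRat 3 W.j < 0 ∨
      (∃ q : ℕ, q.Prime ∧ q ≠ 3 ∧ padicValRat q W.j < 0 ∧ ¬ (3 : ℤ) ∣ padicValRat q W.j) ∨
        W.HasSurjectiveModNGaloisRep 9)
    (htam : padicValNat 3 W.tamagawaProduct ≤ padicValNat 3 ((W.baseChange ℚ_[3]).localTamagawaNumber ℤ_[3]) + 1)
    {q : ℚ} (hq : shaAn W = (q : ℂ)) (hv : padicValRat 3 q = 2) (hSel : W.selmerGroup (3 : ℤ) ≠ ⊥) : BSDp W 3 :=
  bsdp_three_of_x4Cert_of_selmerGroup_ne_bot_tamDefect_of_even W hKato hDel hGZK hmod hmodD hKatoω hCT hr hX hsurj hcert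
    htam hq hv.le (by rw [hv]; exact even_two) hSel

/-! ### §3 No Tamagawa binder: the Tamagawa-EXACT Kato reading A161″ (b2b registry A305) -/

/-- **The typed UPPER half on EVERY X4♯(3) certified row, NO Tamagawa / Manin / parity binder**, on the Tamagawa-EXACT reading A161″ = A305
(`hKatoT`; Kato Thm. 14.5 (3) + Prop. 14.16 (2) + §14.8 with Greenberg LNM 1716 Prop. 4.13: `ord₃ #Ш + v₃(∏ c_ℓ) ≤ ord₃(L(E,1)/Ω)`): binders
{hKatoT, hDel, hGZK, hmod, hmodD, hKatoω} + row data (`ClassX4 W 3`, surj(3), the `3`-adic image certificate) ⟹ `MissingUpperBoundAt W 3`. The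
potentially good branch is n1011 p04's `X4RankZero.missingUpperBoundAt_of_katoTam`. [cite: Kato2004Asterisque, Thm. 14.5 (3) (p. 236), Prop. 14.16 (2) (p. 244), §14.8 (p. 238), Thm. 17.4 (3) (p. 273)]
[cite: GreenbergLNM1716, §4 Prop. 4.13; §3 Lemma 3.3] [cite: Delbourgo1998, Prop. 4 (p. 144)] [cite: Wuthrich2014, Lemma 20 (p. 399)]
[cite: Miller2011LMS, Def. 1.1] -/
theorem missingUpperBoundAt_three_of_x4Cert_katoTam
    (hKatoT : Kato2004.rankZero_padicValNat_sha_add_padicValNat_tamagawa_le_of_additive_potGood_of_imageContainsSL2)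
    (hDel : Delbourgo1998.prop4_rankZero_pow_dvd_constantCoeff)
    (hGZK : rank_eq_analyticRank_of_analyticRank_le_one) (hmod : hasEntireLFunction_rat)
    (hmodD : nonempty_modularParametrizationData)
    (hKatoω : Wuthrich2014.kato_minusEigenCharIdeal_dvd_cyclotomicThree_of_surjective)
    (hr : W.analyticRank = 0) (hX : ClassX4 W 3) (hsurj : Surj W 3)
    (hcert : padicValRat 3 W.j < 0 ∨
      (∃ q : ℕ, q.Prime ∧ q ≠ 3 ∧ padicValRat q W.j < 0 ∧ ¬ (3 : ℤ) ∣ padicValRat q W.j) ∨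
        W.HasSurjectiveModNGaloisRep 9) :
    MissingUpperBoundAt W 3 := by
  haveI : Fact (Nat.Prime 3) := ⟨Nat.prime_three⟩
  by_cases hj : padicValRat 3 W.j < 0
  · exact AdditivePotMult.ClassX4M.missingUpperBoundAt_three_rankZero_of_surj hDel hGZK hmod hmodD
      Wuthrich2014.lemma20_surjective_threeAdic_of_semistable_holds hKatoω ⟨hX, hX.2.1, hj⟩ hr hsurj
  · exact X4RankZero.missingUpperBoundAt_of_katoTam W 3 hKatoT hGZK hmod hr hX (not_lt.mp hj)
      (towerSurj_three_of_cert_of_not_potMult W hsurj hcert hj)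

/-- **`BSD(E,3)` on an X4♯(3) row with `ord₃ #Ш_an ≤ 2` from the certificate line `Sel^(3)(E/ℚ) ≠ 0` — NO Tamagawa binder**: the booked door
`bsdp_three_of_x4Cert_of_selmerGroup_ne_bot_maninFree` with hKato (A161′) REPLACED by the Tamagawa-exact reading hKatoT (A161″ = A305) and the
binder `¬ 3 ∣ ∏ c_ℓ` DELETED; every other binder unchanged: {hKatoT, hDel, hGZK, hmod, hmodD, hKatoω, hCT} + row data + `hSel`. Per pair; nothing
booked here. [cite: Kato2004Asterisque, Thm. 14.5 (3) (p. 236), Prop. 14.16 (2) (p. 244), §14.8 (p. 238), Thm. 17.4 (3) (p. 273)]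
[cite: GreenbergLNM1716, §4 Prop. 4.13; §3 Lemma 3.3] [cite: Delbourgo1998, Prop. 4 (p. 144)] [cite: Wuthrich2014, Lemma 20 (p. 399)]
[cite: SilvermanAEC2009, Thm. X.4.14] [cite: Miller2011LMS, §1 and Def. 1.1] -/
theorem bsdp_three_of_x4Cert_of_selmerGroup_ne_bot_katoTam
    (hKatoT : Kato2004.rankZero_padicValNat_sha_add_padicValNat_tamagawa_le_of_additive_potGood_of_imageContainsSL2)
    (hDel : Delbourgo1998.prop4_rankZero_pow_dvd_constantCoeff)
    (hGZK : rank_eq_analyticRank_of_analyticRank_le_one) (hmod : hasEntireLFunction_rat)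
    (hmodD : nonempty_modularParametrizationData)
    (hKatoω : Wuthrich2014.kato_minusEigenCharIdeal_dvd_cyclotomicThree_of_surjective)
    (hCT : exists_casselsTate_pairing (K := ℚ))
    (hr : W.analyticRank = 0) (hX : ClassX4 W 3) (hsurj : Surj W 3)
    (hcert : padicValRat 3 W.j < 0 ∨
      (∃ q : ℕ, q.Prime ∧ q ≠ 3 ∧ padicValRat q W.j < 0 ∧ ¬ (3 : ℤ) ∣ padicValRat q W.j) ∨
        W.HasSurjectiveModNGaloisRep 9)
    {q : ℚ} (hq : shaAn W = (q : ℂ)) (hv : padicValRat 3 q ≤ 2) (hSel : W.selmerGroup (3 : ℤ) ≠ ⊥) : BSDp W 3 :=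
  haveI : Fact (Nat.Prime 3) := ⟨Nat.prime_three⟩
  bsdp_of_missingPPartAt W 3 hGZK (by rw [hr]; exact zero_le_one)
    (missingPPartAt_of_lower_of_upper W 3
      (Supersingular.missingLowerBoundAt_of_casselsTate_of_selmerGroup_ne_bot W 3 hCT hGZK hr
        (Supersingular.not_dvd_torsionOrder_of_irr W 3 hX.2.2) hq hv hSel)
      (missingUpperBoundAt_three_of_x4Cert_katoTam W hKatoT hDel hGZK hmod hmodD hKatoω hr hX hsurj hcert))

/-! ### §4 Isogeny-class forms (Cassels `hCassels`) -/

/-- **ISOGENY-CLASS form of the defect-`0` door `…_tamLocal`** (Cassels `hCassels`).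
[cite: MilneADT2006, Thm. I.7.3 and Remark I.7.4] [cite: Kato2004Asterisque, Thm. 14.5 (3) (p. 236)] [cite: SilvermanAEC2009, Thm. X.4.14]
[cite: Miller2011LMS, §1 and Def. 1.1] -/
theorem isogenous_bsdp_three_of_x4Cert_of_selmerGroup_ne_bot_tamLocal
    (hCassels : bsdRHS_eq_of_isIsogenous)
    (hKato : Kato2004.rankZero_padicValNat_sha_le_sub_localTamagawa_of_additive_potGood_of_imageContainsSL2_maninFree)
    (hDel : Delbourgo1998.prop4_rankZero_pow_dvd_constantCoeff)
    (hGZK : rank_eq_analyticRank_of_analyticRank_le_one) (hmod : hasEntireLFunction_rat)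
    (hmodD : nonempty_modularParametrizationData)
    (hKatoω : Wuthrich2014.kato_minusEigenCharIdeal_dvd_cyclotomicThree_of_surjective)
    (hCT : exists_casselsTate_pairing (K := ℚ))
    {W' : WeierstrassCurve ℚ} [W'.IsElliptic] [W'.IsGloballyMinimal] (hiso : IsIsogenous W' W)
    (hr : W.analyticRank = 0) (hX : ClassX4 W 3) (hsurj : Surj W 3)
    (hcert : padicValRat 3 W.j < 0 ∨
      (∃ q : ℕ, q.Prime ∧ q ≠ 3 ∧ padicValRat q W.j < 0 ∧ ¬ (3 : ℤ) ∣ padicValRat q W.j) ∨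
        W.HasSurjectiveModNGaloisRep 9)
    (htam : padicValNat 3 W.tamagawaProduct = padicValNat 3 ((W.baseChange ℚ_[3]).localTamagawaNumber ℤ_[3]))
    {q : ℚ} (hq : shaAn W = (q : ℂ)) (hv : padicValRat 3 q ≤ 2) (hSel : W.selmerGroup (3 : ℤ) ≠ ⊥) : BSDp W' 3 := by
  haveI : Fact (Nat.Prime 3) := ⟨Nat.prime_three⟩
  have hr' : W'.analyticRank ≤ 1 := by rw [analyticRank_eq_of_isIsogenous' hiso, hr]; exact zero_le_one
  exact N10.bsdp_of_isIsogenous_of_bsdp 3 hCassels hGZK hmod hiso hr'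
    (bsdp_three_of_x4Cert_of_selmerGroup_ne_bot_tamLocal W hKato hDel hGZK hmod hmodD hKatoω hCT hr hX hsurj hcert htam hq hv hSel)

/-- **ISOGENY-CLASS form of the defect-`≤ 1` census door `…_tamDefect`** (Cassels `hCassels`).
[cite: MilneADT2006, Thm. I.7.3 and Remark I.7.4] [cite: Kato2004Asterisque, Thm. 14.5 (3) (p. 236)] [cite: SilvermanAEC2009, Thm. X.4.14]
[cite: Miller2011LMS, §1 and Def. 1.1] -/
theorem isogenous_bsdp_three_of_x4Cert_of_selmerGroup_ne_bot_tamDefect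
    (hCassels : bsdRHS_eq_of_isIsogenous)
    (hKato : Kato2004.rankZero_padicValNat_sha_le_sub_localTamagawa_of_additive_potGood_of_imageContainsSL2_maninFree)
    (hDel : Delbourgo1998.prop4_rankZero_pow_dvd_constantCoeff)
    (hGZK : rank_eq_analyticRank_of_analyticRank_le_one) (hmod : hasEntireLFunction_rat)
    (hmodD : nonempty_modularParametrizationData)
    (hKatoω : Wuthrich2014.kato_minusEigenCharIdeal_dvd_cyclotomicThree_of_surjective)
    (hCT : exists_casselsTate_pairing (K := ℚ))
    {W' : WeierstrassCurve ℚ} [W'.IsElliptic] [W'.IsGloballyMinimal] (hiso : IsIsogenous W' W)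
    (hr : W.analyticRank = 0) (hX : ClassX4 W 3) (hsurj : Surj W 3)
    (hcert : padicValRat 3 W.j < 0 ∨
      (∃ q : ℕ, q.Prime ∧ q ≠ 3 ∧ padicValRat q W.j < 0 ∧ ¬ (3 : ℤ) ∣ padicValRat q W.j) ∨
        W.HasSurjectiveModNGaloisRep 9)
    (htam : padicValNat 3 W.tamagawaProduct ≤ padicValNat 3 ((W.baseChange ℚ_[3]).localTamagawaNumber ℤ_[3]) + 1)
    {q : ℚ} (hq : shaAn W = (q : ℂ)) (hv : padicValRat 3 q = 2) (hSel : W.selmerGroup (3 : ℤ) ≠ ⊥) : BSDp W' 3 := by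
  haveI : Fact (Nat.Prime 3) := ⟨Nat.prime_three⟩
  have hr' : W'.analyticRank ≤ 1 := by rw [analyticRank_eq_of_isIsogenous' hiso, hr]; exact zero_le_one
  exact N10.bsdp_of_isIsogenous_of_bsdp 3 hCassels hGZK hmod hiso hr'
    (bsdp_three_of_x4Cert_of_selmerGroup_ne_bot_tamDefect W hKato hDel hGZK hmod hmodD hKatoω hCT hr hX hsurj hcert htam hq hv hSel)

/-- **ISOGENY-CLASS form of the Tamagawa-free door `…_katoTam`** (Cassels `hCassels`).
[cite: MilneADT2006, Thm. I.7.3 and Remark I.7.4] [cite: Kato2004Asterisque, Thm. 14.5 (3) (p. 236), §14.8 (p. 238)]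
[cite: GreenbergLNM1716, §4 Prop. 4.13] [cite: SilvermanAEC2009, Thm. X.4.14] [cite: Miller2011LMS, §1 and Def. 1.1] -/
theorem isogenous_bsdp_three_of_x4Cert_of_selmerGroup_ne_bot_katoTam
    (hCassels : bsdRHS_eq_of_isIsogenous)
    (hKatoT : Kato2004.rankZero_padicValNat_sha_add_padicValNat_tamagawa_le_of_additive_potGood_of_imageContainsSL2)
    (hDel : Delbourgo1998.prop4_rankZero_pow_dvd_constantCoeff)
    (hGZK : rank_eq_analyticRank_of_analyticRank_le_one) (hmod : hasEntireLFunction_rat)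
    (hmodD : nonempty_modularParametrizationData)
    (hKatoω : Wuthrich2014.kato_minusEigenCharIdeal_dvd_cyclotomicThree_of_surjective)
    (hCT : exists_casselsTate_pairing (K := ℚ))
    {W' : WeierstrassCurve ℚ} [W'.IsElliptic] [W'.IsGloballyMinimal] (hiso : IsIsogenous W' W)
    (hr : W.analyticRank = 0) (hX : ClassX4 W 3) (hsurj : Surj W 3)
    (hcert : padicValRat 3 W.j < 0 ∨
      (∃ q : ℕ, q.Prime ∧ q ≠ 3 ∧ padicValRat q W.j < 0 ∧ ¬ (3 : ℤ) ∣ padicValRat q W.j) ∨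
        W.HasSurjectiveModNGaloisRep 9)
    {q : ℚ} (hq : shaAn W = (q : ℂ)) (hv : padicValRat 3 q ≤ 2) (hSel : W.selmerGroup (3 : ℤ) ≠ ⊥) : BSDp W' 3 := by
  haveI : Fact (Nat.Prime 3) := ⟨Nat.prime_three⟩
  have hr' : W'.analyticRank ≤ 1 := by rw [analyticRank_eq_of_isIsogenous' hiso, hr]; exact zero_le_one
  exact N10.bsdp_of_isIsogenous_of_bsdp 3 hCassels hGZK hmod hiso hr'
    (bsdp_three_of_x4Cert_of_selmerGroup_ne_bot_katoTam W hKatoT hDel hGZK hmod hmodD hKatoω hCT hr hX hsurj hcert hq hv hSel)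

/-! ### §5 Bookkeeping: the booked binder `¬ 3 ∣ ∏ c_ℓ` implies both new Tamagawa binders -/

omit [W.IsGloballyMinimal] in
/-- `¬ p ∣ ∏_ℓ c_ℓ` ⟹ `ord_p ∏_ℓ c_ℓ ≤ v_p(c_p) + 1` (both sides' Tamagawa terms vanish). So every KUR3 cell-U row (the booked door's clientele)
also satisfies §2's binder: one table serves U ∪ C. Bookkeeping. [folklore] -/
theorem padicValNat_tamagawaProduct_le_localTamagawa_add_one_of_not_dvd (p : ℕ) [Fact p.Prime]
    (htam : ¬ p ∣ W.tamagawaProduct) :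
    padicValNat p W.tamagawaProduct ≤ padicValNat p ((W.baseChange ℚ_[p]).localTamagawaNumber ℤ_[p]) + 1 := by
  rw [padicValNat_tamagawaProduct_eq_localTamagawa_of_not_dvd W p htam]
  exact Nat.le_succ _

end Summit.BirchSwinnertonDyer.BirchSwinnertonDyer.Theorems.AdditiveBranchIMCGordTwoRankZeroDesc3

end
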